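import Summits.CriticalPhenomena.PercolationContinuityZ3.Theorems.SahiAEOrthantShift
import Summits.CriticalPhenomena.PercolationContinuityZ3.Theorems.SahiAEOrthantBox
import Summits.CriticalPhenomena.PercolationContinuityZ3.Theorems.SahiAEBorelVersionPi

/-!
# Boxed orthant versions, line factors and line corrections (preliminaries for the band theorem)

Support file of the Sahi cell (`prim-sahi`, typer seat, generation 24; `--supports stmt-CriticalPhenomena-4575`).
Three small definitions (`boxVersion`, `lineFactor`, `lineCorrection`), theorems otherwise; no named facts,
no sorries.

The orthant machinery of generation 23 (`SahiAEOrthantVersion/Shift/Gluing.lean`: axis sums `S_c`, orthant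
versions `ψ_c = log F_c + S_c`, base corrections) assumes that `φ : ℝ^ι → ℝ` is supermodular on almost every pair
of THE WHOLE SPACE.  For densities with zeros (the band theorem, `SahiAEBand*.lean`) the hypothesis only holds on the
pairs of an open sublattice `B`, and the machinery is applied to auxiliary functions which agree with `φ` on a closed
box `K ⊆ B` and are almost everywhere equal to an everywhere-supermodular function (`SahiAEOrthantBox.lean`,
`exists_supermodular_clampExtension_of_box`).  This file supplies the glue:

* `ae_supermodular_of_ae_eq` — a function a.e. equal to an everywhere-supermodular one is supermodular on almost
  every pair (quasi-invariance of `λ ⊗ λ` under `∧`, `∨`);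
* LOCALITY: `orthantVersion φ c p` only depends on `φ` on the order interval `[c, p]` (`orthantVersion_congr`;
  the orthant density vanishes off `O_c` and the corner boxes at `p` lie below `p`); hence the canonical
  **boxed version** `boxVersion φ c p = orthantVersion (φ ∘ clamp_[c,p]) c p` (`orthantVersion_eq_boxVersion`);
* the **line factors** `Lᵢ(x) = exp(φ(c; i := xᵢ) − φ(c'; i := xᵢ))` (`lineFactor`; the base factor
  `exp(S_c − S_{c'})` of `SahiAEOrthantShift.lean` is their product times a constant) and the **line corrections**
  `Λᵢ = log cornerEnvelope Lᵢ − log Lᵢ` (`lineCorrection`), with their locality (`cornerEnvelope_lineFactor_congr`)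
  and their dependence on `c, c'` only through the coordinates `≠ i` (`lineFactor_congr_base`);
* HORIZONTALITY: the envelope of a function of the single coordinate `xᵢ` is a function of `pᵢ` alone
  (`cornerEnvelope_comp_eval`: translation invariance of Lebesgue measure and `essSup_map_measure`), so
  `Λᵢ(p)` only depends on `pᵢ` (`lineCorrection_eq_of_apply_eq`);
* lifting one-dimensional a.e. monotonicity to comparable pairs of `ℝ^ι` (`ae_monotone_comp_eval`).

No sorries, no new axioms.
-/

noncomputable section

namespace Summit.CriticalPhenomena.PercolationContinuityZ3.Theorems.SahiAEFourFunctions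

open MeasureTheory Set Filter Topology Function
open scoped ENNReal NNReal

variable {ι : Type*} [Fintype ι] [DecidableEq ι]

/-! ### Almost-everywhere supermodularity from an everywhere-supermodular version -/

omit [DecidableEq ι] in
/-- **A function almost everywhere equal to an everywhere-supermodular function is supermodular on almost every
pair** (Lebesgue reference measure; quasi-invariance of `λ ⊗ λ` under meet and join). [this work] -/
theorem ae_supermodular_of_ae_eq {φ g : (ι → ℝ) → ℝ} (hg : ∀ x y, g x + g y ≤ g (x ⊓ y) + g (x ⊔ y))
    (h : φ =ᵐ[(volume : Measure (ι → ℝ))] g) :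
    ∀ᵐ p ∂(volume : Measure (ι → ℝ)).prod volume, φ p.1 + φ p.2 ≤ φ (p.1 ⊓ p.2) + φ (p.1 ⊔ p.2) := by
  have h' : ∀ᵐ u ∂Measure.pi (fun _ : ι => (volume : Measure ℝ)), u ∈ {x : ι → ℝ | φ x = g x} := by
    rw [← volume_pi]
    filter_upwards [h] with u hu
    exact hu
  have h2 := ae_prod_mem_inf_sup_of_sigmaFinite (fun _ : ι => (volume : Measure ℝ)) h'
  rw [← volume_pi] at h2
  filter_upwards [h2] with p hp
  have e1 : φ p.1 = g p.1 := hp.1.1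
  have e2 : φ p.2 = g p.2 := hp.1.2
  have e3 : φ (p.1 ⊓ p.2) = g (p.1 ⊓ p.2) := hp.2.1
  have e4 : φ (p.1 ⊔ p.2) = g (p.1 ⊔ p.2) := hp.2.2
  rw [e1, e2, e3, e4]
  exact hg _ _

/-! ### Locality of the orthant version -/

omit [Fintype ι] in
/-- Points of the axis cross between `c` and `x ∈ [c, p]` lie in `[c, p]`. [folklore] -/
theorem update_mem_Icc {c p x : ι → ℝ} (hcp : c ≤ p) (hx : x ∈ Icc c p) (i : ι) : update c i (x i) ∈ Icc c p := by
  refine ⟨fun j => ?_, fun j => ?_⟩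
  · by_cases hj : j = i
    · subst hj; rw [update_self]; exact hx.1 j
    · rw [update_of_ne hj]
  · by_cases hj : j = i
    · subst hj; rw [update_self]; exact hx.2 j
    · rw [update_of_ne hj]; exact hcp j

/-- **Locality of the axis sum**: on `[c, p]` it only reads `φ` on `[c, p]`. [folklore] -/
theorem axisSum_congr {φ φ' : (ι → ℝ) → ℝ} {c p : ι → ℝ} (hcp : c ≤ p) (h : ∀ x ∈ Icc c p, φ' x = φ x)
    {x : ι → ℝ} (hx : x ∈ Icc c p) : axisSum φ' c x = axisSum φ c x := by
  unfold axisSum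
  rw [h c ⟨le_rfl, hcp⟩]
  congr 1
  exact Finset.sum_congr rfl fun i _ => h _ (update_mem_Icc hcp hx i)

/-- **Locality of the orthant density** below `p`. [folklore] -/
theorem orthantDensity_congr {φ φ' : (ι → ℝ) → ℝ} {c p : ι → ℝ} (h : ∀ x ∈ Icc c p, φ' x = φ x)
    {x : ι → ℝ} (hx : x ≤ p) : orthantDensity φ' c x = orthantDensity φ c x := by
  by_cases hxO : x ∈ Set.pi univ fun i => Ioi (c i)
  · have hcx : ∀ i, c i < x i := mem_orthant_iff.1 hxO
    have hcp : c ≤ p := fun i => (hcx i).le.trans (hx i)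
    have hxI : x ∈ Icc c p := ⟨fun i => (hcx i).le, hx⟩
    rw [orthantDensity_of_mem hxO, orthantDensity_of_mem hxO, h x hxI, axisSum_congr hcp h hxI]
  · rw [orthantDensity_of_not_mem hxO, orthantDensity_of_not_mem hxO]

/-- **Locality of the envelope of the orthant density** at `p`. [this work] -/
theorem cornerEnvelope_orthantDensity_congr {φ φ' : (ι → ℝ) → ℝ} {c p : ι → ℝ}
    (h : ∀ x ∈ Icc c p, φ' x = φ x) :
    cornerEnvelope (orthantDensity φ' c) p = cornerEnvelope (orthantDensity φ c) p :=
  cornerEnvelope_congr_of_eqOn 0 fun _ hy => orthantDensity_congr h (le_of_mem_lowerCorner hy)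

/-- **Locality of the orthant version**: `orthantVersion φ c p` only depends on `φ` on the order interval `[c, p]`.
[this work] -/
theorem orthantVersion_congr {φ φ' : (ι → ℝ) → ℝ} {c p : ι → ℝ} (hcp : c ≤ p) (h : ∀ x ∈ Icc c p, φ' x = φ x) :
    orthantVersion φ' c p = orthantVersion φ c p := by
  simp only [orthantVersion]
  rw [cornerEnvelope_orthantDensity_congr h, axisSum_congr hcp h ⟨hcp, le_rfl⟩]

/-- **The boxed version** `boxVersion φ c p = orthantVersion (φ ∘ clamp_[c,p]) c p`: the orthant version computed
from the values of `φ` on `[c, p]` alone (a canonical quantity, whatever `φ` does elsewhere). [this work] -/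
def boxVersion (φ : (ι → ℝ) → ℝ) (c p : ι → ℝ) : ℝ := orthantVersion (fun x => φ ((x ⊔ c) ⊓ p)) c p

/-- **Any function agreeing with `φ` on `[c, p]` computes the boxed version.** [this work] -/
theorem orthantVersion_eq_boxVersion {φ φ' : (ι → ℝ) → ℝ} {c p : ι → ℝ} (hcp : c ≤ p)
    (h : ∀ x ∈ Icc c p, φ' x = φ x) : orthantVersion φ' c p = boxVersion φ c p :=
  orthantVersion_congr hcp fun x hx => by
    rw [h x hx]
    show φ x = φ ((x ⊔ c) ⊓ p)
    rw [clamp_of_mem_Icc hx]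

/-! ### Line factors and line corrections -/

/-- **The line factor** `Lᵢ(x) = exp(φ(c; i := xᵢ) − φ(c'; i := xᵢ))` between the axis sections through `c` and
`c'` in direction `i` (a function of `xᵢ` alone). [this work] -/
def lineFactor (φ : (ι → ℝ) → ℝ) (i : ι) (c c' : ι → ℝ) : (ι → ℝ) → ℝ≥0∞ := fun x =>
  ENNReal.ofReal (Real.exp (φ (update c i (x i)) - φ (update c' i (x i))))

/-- **The line correction** `Λᵢ = log cornerEnvelope Lᵢ − log Lᵢ`. [this work] -/
def lineCorrection (φ : (ι → ℝ) → ℝ) (i : ι) (c c' : ι → ℝ) : (ι → ℝ) → ℝ := fun x =>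
  Real.log (cornerEnvelope (lineFactor φ i c c') x).toReal - (φ (update c i (x i)) - φ (update c' i (x i)))

omit [Fintype ι] in
/-- The line factor is measurable. [folklore] -/
theorem measurable_lineFactor {φ : (ι → ℝ) → ℝ} (hφ : Measurable φ) (i : ι) (c c' : ι → ℝ) :
    Measurable (lineFactor φ i c c') := by
  unfold lineFactor
  refine ENNReal.measurable_ofReal.comp (Real.measurable_exp.comp ?_)
  exact (hφ.comp ((measurable_update c).comp (measurable_pi_apply i))).sub
    (hφ.comp ((measurable_update c').comp (measurable_pi_apply i)))

omit [Fintype ι] in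
/-- The line factor is non-zero. [folklore] -/
theorem lineFactor_ne_zero (φ : (ι → ℝ) → ℝ) (i : ι) (c c' x : ι → ℝ) : lineFactor φ i c c' x ≠ 0 :=
  (ENNReal.ofReal_pos.2 (Real.exp_pos _)).ne'

omit [Fintype ι] in
/-- The line factor is finite. [folklore] -/
theorem lineFactor_ne_top (φ : (ι → ℝ) → ℝ) (i : ι) (c c' x : ι → ℝ) : lineFactor φ i c c' x ≠ ∞ :=
  ENNReal.ofReal_ne_top

omit [Fintype ι] in
/-- The real value of the line factor. [folklore] -/
theorem toReal_lineFactor (φ : (ι → ℝ) → ℝ) (i : ι) (c c' x : ι → ℝ) :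
    (lineFactor φ i c c' x).toReal = Real.exp (φ (update c i (x i)) - φ (update c' i (x i))) :=
  ENNReal.toReal_ofReal (Real.exp_pos _).le

omit [Fintype ι] in
/-- The line factor as a function of the single coordinate `xᵢ`. [folklore] -/
theorem lineFactor_eq_comp_eval (φ : (ι → ℝ) → ℝ) (i : ι) (c c' : ι → ℝ) :
    lineFactor φ i c c' = fun x => (fun s : ℝ => ENNReal.ofReal (Real.exp (φ (update c i s) - φ (update c' i s)))) (x i) :=
  rfl

omit [Fintype ι] in
/-- The one-dimensional profile of the line factor is measurable. [folklore] -/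
theorem measurable_lineProfile {φ : (ι → ℝ) → ℝ} (hφ : Measurable φ) (i : ι) (c c' : ι → ℝ) :
    Measurable fun s : ℝ => ENNReal.ofReal (Real.exp (φ (update c i s) - φ (update c' i s))) :=
  ENNReal.measurable_ofReal.comp (Real.measurable_exp.comp
    ((hφ.comp (measurable_update c)).sub (hφ.comp (measurable_update c'))))

/-- The line correction is measurable. [folklore] -/
theorem measurable_lineCorrection {φ : (ι → ℝ) → ℝ} (hφ : Measurable φ) (i : ι) (c c' : ι → ℝ) :
    Measurable (lineCorrection φ i c c') := by
  unfold lineCorrection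
  refine (Real.measurable_log.comp (ENNReal.measurable_toReal.comp
    (measurable_cornerEnvelope (measurable_lineFactor hφ i c c')))).sub ?_
  exact (hφ.comp ((measurable_update c).comp (measurable_pi_apply i))).sub
    (hφ.comp ((measurable_update c').comp (measurable_pi_apply i)))

omit [Fintype ι] in
/-- Updating in direction `i` forgets the `i`-th coordinate of the base point. [folklore] -/
theorem update_eq_update_of_forall_ne {c d : ι → ℝ} {i : ι} (hcd : ∀ j, j ≠ i → c j = d j) (s : ℝ) :
    update c i s = update d i s := by
  funext j
  by_cases hj : j = i
  · subst hj; rw [update_self, update_self]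
  · rw [update_of_ne hj, update_of_ne hj, hcd j hj]

omit [Fintype ι] in
/-- **The line factor only depends on the base points through their coordinates `≠ i`.** [folklore] -/
theorem lineFactor_congr_base {φ : (ι → ℝ) → ℝ} {i : ι} {c c' d d' : ι → ℝ} (hcd : ∀ j, j ≠ i → c j = d j)
    (hcd' : ∀ j, j ≠ i → c' j = d' j) : lineFactor φ i c c' = lineFactor φ i d d' := by
  funext x
  simp only [lineFactor, update_eq_update_of_forall_ne hcd, update_eq_update_of_forall_ne hcd']

/-- **The line correction only depends on the base points through their coordinates `≠ i`.** [folklore] -/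
theorem lineCorrection_congr_base {φ : (ι → ℝ) → ℝ} {i : ι} {c c' d d' : ι → ℝ} (hcd : ∀ j, j ≠ i → c j = d j)
    (hcd' : ∀ j, j ≠ i → c' j = d' j) : lineCorrection φ i c c' = lineCorrection φ i d d' := by
  funext x
  simp only [lineCorrection, lineFactor_congr_base hcd hcd', update_eq_update_of_forall_ne hcd,
    update_eq_update_of_forall_ne hcd']

/-- **Locality of the line factor**: two functions which agree at the points `(c; i := s)`, `(c'; i := s)` for
`s ∈ (pᵢ − rₙ, pᵢ]` have line factors with the same envelope at `p`. [this work] -/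
theorem cornerEnvelope_lineFactor_congr {φ φ' : (ι → ℝ) → ℝ} {i : ι} {c c' p : ι → ℝ} (n : ℕ)
    (h : ∀ s ∈ Ioc (p i - cornerRadius n) (p i),
      φ' (update c i s) = φ (update c i s) ∧ φ' (update c' i s) = φ (update c' i s)) :
    cornerEnvelope (lineFactor φ' i c c') p = cornerEnvelope (lineFactor φ i c c') p := by
  refine cornerEnvelope_congr_of_eqOn n fun y hy => ?_
  have hyi : y i ∈ Ioc (p i - cornerRadius n) (p i) := (Set.mem_univ_pi.1 hy i)
  simp only [lineFactor, (h (y i) hyi).1, (h (y i) hyi).2]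

/-! ### Horizontality: envelopes of functions of one coordinate -/

omit [Fintype ι] [DecidableEq ι] in
/-- Translating by a vector with vanishing `i`-th coordinate maps corner boxes to corner boxes. [folklore] -/
theorem preimage_add_lowerCorner {p q : ι → ℝ} (ε : ℝ) :
    (fun x : ι → ℝ => x + (q - p)) ⁻¹' (Set.pi univ fun j => Ioc (q j - ε) (q j)) =
      Set.pi univ fun j => Ioc (p j - ε) (p j) := by
  ext x
  simp only [Set.mem_preimage, Set.mem_univ_pi, Set.mem_Ioc, Pi.add_apply, Pi.sub_apply]
  refine forall_congr' fun j => ?_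
  constructor
  · rintro ⟨h1, h2⟩; constructor <;> linarith
  · rintro ⟨h1, h2⟩; constructor <;> linarith

omit [DecidableEq ι] in
/-- **The corner essential suprema of a function of the single coordinate `xᵢ` only depend on `pᵢ`** (translation
invariance of Lebesgue measure in the other directions). [this work] -/
theorem cornerEssSup_comp_eval {ℓ : ℝ → ℝ≥0∞} (hℓ : Measurable ℓ) (i : ι) {p q : ι → ℝ} (hpq : p i = q i)
    (n : ℕ) : cornerEssSup (fun x : ι → ℝ => ℓ (x i)) n p = cornerEssSup (fun x : ι → ℝ => ℓ (x i)) n q := by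
  simp only [cornerEssSup_def]
  set T : (ι → ℝ) → (ι → ℝ) := fun x => x + (q - p) with hT
  have hTm : Measurable T := measurable_id.add_const _
  have hg : Measurable fun x : ι → ℝ => ℓ (x i) := hℓ.comp (measurable_pi_apply i)
  have hmap : ((volume : Measure (ι → ℝ)).restrict (Set.pi univ fun j => Ioc (p j - cornerRadius n) (p j))).map T =
      (volume : Measure (ι → ℝ)).restrict (Set.pi univ fun j => Ioc (q j - cornerRadius n) (q j)) := by
    rw [← preimage_add_lowerCorner (p := p) (q := q) (cornerRadius n), ← Measure.restrict_map hTm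
      (measurableSet_lowerCorner q _), hT, map_add_right_eq_self]
  rw [← hmap, essSup_map_measure hg.aemeasurable hTm.aemeasurable]
  congr 1
  funext x
  simp only [Function.comp_apply, hT, Pi.add_apply, Pi.sub_apply, ← hpq, sub_self, add_zero]

omit [DecidableEq ι] in
/-- **The envelope of a function of the single coordinate `xᵢ` only depends on `pᵢ`.** [this work] -/
theorem cornerEnvelope_comp_eval {ℓ : ℝ → ℝ≥0∞} (hℓ : Measurable ℓ) (i : ι) {p q : ι → ℝ} (hpq : p i = q i) :
    cornerEnvelope (fun x : ι → ℝ => ℓ (x i)) p = cornerEnvelope (fun x : ι → ℝ => ℓ (x i)) q := by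
  simp only [cornerEnvelope_def, cornerEssSup_comp_eval hℓ i hpq]

/-- **The line correction `Λᵢ(p)` only depends on `pᵢ`.** [this work] -/
theorem lineCorrection_eq_of_apply_eq {φ : (ι → ℝ) → ℝ} (hφ : Measurable φ) {i : ι} {c c' p q : ι → ℝ}
    (hpq : p i = q i) : lineCorrection φ i c c' p = lineCorrection φ i c c' q := by
  simp only [lineCorrection, hpq]
  rw [lineFactor_eq_comp_eval, cornerEnvelope_comp_eval (measurable_lineProfile hφ i c c') i hpq]

/-! ### One-dimensional monotonicity lifted to comparable pairs -/

omit [DecidableEq ι] in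
/-- **Lifting a.e. monotonicity**: if `ℓ` is non-decreasing on almost every comparable pair of reals then
`x ↦ ℓ(xᵢ)` is non-decreasing on almost every comparable pair of `ℝ^ι`. [folklore] -/
theorem ae_monotone_comp_eval {ℓ : ℝ → ℝ≥0∞} (i : ι)
    (h : ∀ᵐ rt ∂(volume : Measure ℝ).prod (volume : Measure ℝ), rt.1 ≤ rt.2 → ℓ rt.1 ≤ ℓ rt.2) :
    ∀ᵐ p ∂(volume : Measure (ι → ℝ)).prod volume, p.1 ≤ p.2 → ℓ (p.1 i) ≤ ℓ (p.2 i) := by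
  have h2 := (MeasureTheory.QuasiMeasurePreserving.prodMap
    (SahiAESeparableTilt.quasiMeasurePreserving_eval (ι := ι) i)
    (SahiAESeparableTilt.quasiMeasurePreserving_eval (ι := ι) i)).ae h
  filter_upwards [h2] with p hp hle
  exact hp (hle i)

omit [DecidableEq ι] in
/-- A function of one coordinate which is a.e. non-decreasing there and finite everywhere has finite corner essential
suprema and a finite, non-zero envelope (if it is non-zero everywhere). [this work] -/
theorem cornerEssSup_comp_eval_ne_top {ℓ : ℝ → ℝ≥0∞} (i : ι) (hT : ∀ s, ℓ s ≠ ∞)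
    (h : ∀ᵐ rt ∂(volume : Measure ℝ).prod (volume : Measure ℝ), rt.1 ≤ rt.2 → ℓ rt.1 ≤ ℓ rt.2)
    (n : ℕ) (p : ι → ℝ) : cornerEssSup (fun x : ι → ℝ => ℓ (x i)) n p ≠ ∞ :=
  cornerEssSup_ne_top_of_local (local_bound_of_ae_monotone (fun x => hT (x i)) (ae_monotone_comp_eval i h)) n p

end Summit.CriticalPhenomena.PercolationContinuityZ3.Theorems.SahiAEFourFunctions
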